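import Summits.BirchSwinnertonDyer.BirchSwinnertonDyer.Theorems.EisensteinPrimesMazurMCOnCellBTwistbackSubrowCarrierEven
import Summits.BirchSwinnertonDyer.BirchSwinnertonDyer.Theorems.EisensteinPrimesMazurMCOnCellBTwistbackLamOnePartner
import HarnessLib

/-!
# Crux 3 `MazurMCOnCellB` (stmt-BirchSwinnertonDyer-19033), line `twistback` v4 — the SUB-ROW ASSEMBLY, part 3a:
# stub 6 (∃-PARTNER) AT a non-split X2b pair `(W, p)` from a balance-one line datum of `W`, ONE admissible `K`
# prime to the levels and ONE class number — the doors p645525 §3 / p650387 fed with the CONSTRUCTED carrier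

LEAD bsd-line-x2-p1 g11 (2026-08-28). HONEST FRAMING (cell `bsd-eis`, run/shared/lean/pub/bsd-eis/): conditional
theorems only. Named facts taken as hypotheses BY NAME (nothing asserted, nothing introduced): the route's
`PublishedInputs` (stmt-…-19037), Disegni 2020 Thm. 4(1) (PUB), Greenberg–Vatsal Thm. (3.11) (PUB), and — in the
`_of_thmE` variants only — Dokchitser–Dokchitser 2010 Thm. 1.4 (`selmerCorank_mod_two_eq`, PUB) and the `p`-converse
`KellerYin2024.thmE_pConverse_semistable_OPEN` (Keller–Yin arXiv:2402.12781v2 Thm. E, an UNREFEREED PREPRINT resting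
on Castella arXiv:2409.01360; the line already carries Keller–Yin Thm. D as stub 3a). `--supports`
stmt-BirchSwinnertonDyer-19033; no `def`, no `sorry`; closes no registered stub; no summit statement, no Mazur main
conjecture and no BSD is proved for any curve unconditionally; 0 cells / labels / tiers move.

WHAT. Parts 1–2 (`…TwistbackSubrowCarrier`, p653533; `…TwistbackSubrowCarrierEven`, p653853) turned the binder `hKL`
of the doors into a THEOREM about `(E, K)`. This file plugs it in:

* §1 (FIRST X2b shape: line of `E` ramified-odd) `upperPartner_at_of_ramifiedOdd_of_classNumber` — stub 6's
  conclusion at `(W, p)` VERBATIM from LEAD g10's door p645525 §3: PUBLISHED inputs + the per-pair data «admissible `K`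
  with `gcd(md, d_K) = 1`, `p ∤ h(−d·|d_K|)`, `ord_{s=1} L(E^{(d_K)}, s) = 1`»; and
  `upperPartner_at_of_ramifiedOdd_of_classNumber_of_thmE` — the same WITHOUT the analytic rank, from w5's door p650387
  (Keller–Yin Thm. E, PRE).
* §2 (SECOND shape: line unramified-even) `upperPartner_at_of_unramifiedEven_of_classNumber{,_of_thmE}`.
* (part 3b `…TwistbackSubrowPartner`: at `p = 3` the field `K` is CHOSEN by Nakagawa–Horie–Taya.)

References: [GreenbergVatsal2000] Thm. (1.3), §2 p. 28, §3 Thm. (3.11); [KellerYin2024] Thm. E (PRE);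
[DokchitserDokchitserAnnals2010] Thm. 1.4; [Disegni2020] Thm. 4; [Wuthrich2014] Thm. 16; [Washington1997] Thm. 4.17;
[Cox2013] Thm. 7.7 (ii).
-/

set_option autoImplicit false

-- `Summit.BirchSwinnertonDyer.BirchSwinnertonDyer.…`: the summit and its single sub-problem share a name.
set_option linter.dupNamespace false

noncomputable section

open scoped Classical MatrixGroups ModularForm NumberTheorySymbols

open CongruenceSubgroup WeierstrassCurve NumberField IsDedekindDomain Field DirichletCharacter Rat.HeightOneSpectrum
  Literature.NumberTheory.EllipticCurves Literature.NumberTheory.GaloisRepresentations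
  Literature.NumberTheory.EllipticCurves.ModularForms Literature.NumberTheory.QuadraticFields
  Literature.NumberTheory.EllipticCurves.Rank1Residual Literature.NumberTheory.EllipticCurves.Rank1Residual.Typed
  Literature.NumberTheory.EllipticCurves.Wuthrich2014 Literature.NumberTheory.EllipticCurves.GreenbergVatsal2000
  Literature.NumberTheory.EllipticCurves.Disegni2020 Literature.NumberTheory.EllipticCurves.KellerYin2024
  Summit.BirchSwinnertonDyer.Rank1Residual Summit.BirchSwinnertonDyer.Rank1Residual.X2
  Summit.BirchSwinnertonDyer.BirchSwinnertonDyer.Theses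
  Summit.BirchSwinnertonDyer.BirchSwinnertonDyer.Theorems.EisensteinPrimesLineWeilRelation
  Summit.BirchSwinnertonDyer.BirchSwinnertonDyer.Theorems.EisensteinPrimesMazurMCOnCellBTwistbackKLFlatPartner
  Summit.BirchSwinnertonDyer.BirchSwinnertonDyer.Theorems.EisensteinPrimesMazurMCOnCellBTwistbackLamOnePartner
  Summit.BirchSwinnertonDyer.BirchSwinnertonDyer.Theorems.EisensteinPrimesMazurMCOnCellBTwistbackSubrowCarrier
  Summit.BirchSwinnertonDyer.BirchSwinnertonDyer.Theorems.EisensteinPrimesMazurMCOnCellBTwistbackSubrowCarrierEven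
  Summit.BirchSwinnertonDyer.BirchSwinnertonDyer.Theorems.EisensteinPrimesMazurMCOnCellBTwistbackPartnerClassNumberLift
  Summit.BirchSwinnertonDyer.BirchSwinnertonDyer.Theorems.EisensteinPrimesLinePsiAtMultiplicativePrime
  Summit.BirchSwinnertonDyer.BirchSwinnertonDyer.Theorems.EisensteinPrimesLinePhiAtMultiplicativePrime

namespace Summit.BirchSwinnertonDyer.BirchSwinnertonDyer.Theorems.EisensteinPrimesMazurMCOnCellBTwistbackSubrowPartnerGiven

/-! ## §0. Two arithmetic helpers -/

/-- An odd field discriminant of a quadratic field is `≡ 1 (mod 4)` (Stickelberger). [cite: Cox2013, §2.A] -/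
theorem discr_emod_four_eq_one_of_odd {K : Type} [Field K] [NumberField K] (h2 : Module.finrank ℚ K = 2)
    (hodd : Odd (NumberField.discr K)) : NumberField.discr K % 4 = 1 := by
  rcases Quadratic.isFundamentalDiscriminant_discr (K := K) h2 with ⟨h, -, -⟩ | ⟨h4, -, -⟩
  · exact h
  · exfalso
    obtain ⟨k, hk⟩ := hodd
    omega

/-- `δ ≡ 1 (mod M)` and `n ∣ M` ⟹ `gcd(n, |δ|) = 1`. [folklore] -/
theorem coprime_natAbs_of_modEq_one {δ M : ℤ} (hmod : δ ≡ 1 [ZMOD M]) {n : ℕ} (hn : (n : ℤ) ∣ M) :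
    n.Coprime δ.natAbs := by
  have h1 : (n : ℤ) ∣ 1 - δ := (Int.ModEq.dvd (hmod.of_dvd hn))
  obtain ⟨c, hc⟩ := h1
  have hcop : IsCoprime (n : ℤ) δ := ⟨c, 1, by linarith⟩
  have h := Int.isCoprime_iff_gcd_eq_one.mp hcop
  rwa [Int.gcd_eq_natAbs, Int.natAbs_natCast] at h

/-! ## §1. FIRST shape (line of `E` ramified-odd), `K` given: stub 6 at `(W, p)` -/

section Given

variable (W : WeierstrassCurve ℚ) [W.IsElliptic] [W.IsGloballyMinimal] (p : ℕ) [Fact p.Prime]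

/-- **Stub 6 (∃-PARTNER) AT `(W, p)`, FIRST shape, PUBLISHED inputs + the twist's analytic rank.** Non-split X2b
`(W, p)`; a rational line RAMIFIED-ODD with primitive `(φ, ψ)`, `ψ` quadratic-valued; `S₀ ∌ p`, `W` good off
`S₀ ∪ {p}`, LOCAL BALANCE ONE; an admissible `K` (Heegner for `N_W` and `p`, `d_K` odd `< −4`) with the places of
`S₀` dividing a level `N₀` for which `K` is Heegner, `gcd(m, d_K) = gcd(d, d_K) = 1`, `p ∤ h(−d·|d_K|)`, and
`ord_{s=1} L(E^{(d_K)}, s) = 1` ⟹ the partner clause of `stub_upperPartner` at `(W, p)`. LEAD g10's door p645525 §3 fed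
with part 1's carrier. Inputs BY NAME: `PublishedInputs`, Disegni Thm. 4(1), GV Thm. (3.11) — all PUBLISHED.
[cite: GreenbergVatsal2000, §3 Thm. (3.11) (p. 43)] [cite: Disegni2020, Thm. 4 (§3.2)] [cite: Wuthrich2014, Thm. 16 (p. 397)] -/
theorem upperPartner_at_of_ramifiedOdd_of_classNumber (hP : EisensteinPrimes.PublishedInputs)
    (hDis : padicBSD_rankOne_nonsplitMult) (h311 : thm311_hasUnitContent_iff_and_order_eq_of_lineRamifiedEven)
    (hc : X2.CellB W p) (hns : ¬ W.HasSplitMultiplicativeReductionAtPrime p)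
    {Φ₀ : AddSubgroup (geomTorsion W (p : ℤ))} (hΦ : IsRationalLine W p Φ₀)
    (hram : ¬ LineUnramifiedAt W p Φ₀) (hodd : LineOdd W p Φ₀)
    {m : ℕ} [NeZero m] (φ : DirichletCharacter (ZMod p) m) {d : ℕ} [NeZero d]
    (ψ : DirichletCharacter (ZMod p) d) (hφ : φ.IsPrimitive) (hψ : ψ.IsPrimitive) (hpm : p ∣ m)
    (hpd : ¬ p ∣ d) (hquad : ψ.IsQuadratic)
    (hφ0 : ∀ (σ : absoluteGaloisGroup ℚ), ∀ P ∈ Φ₀,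
      σ • P = (φ ((modNCyclotomicCharacter ℚ m σ : (ZMod m)ˣ) : ZMod m)).val • P)
    (hψ0 : ∀ (σ : absoluteGaloisGroup ℚ) (P : geomTorsion W (p : ℤ)),
      σ • P - (ψ ((modNCyclotomicCharacter ℚ d σ : (ZMod d)ˣ) : ZMod d)).val • P ∈ Φ₀)
    (S₀ : Finset (HeightOneSpectrum (𝓞 ℚ))) (hS₀p : ∀ v ∈ S₀, ((p : ℕ) : 𝓞 ℚ) ∉ v.asIdeal)
    (hS : ∀ v : HeightOneSpectrum (𝓞 ℚ), v ∉ S₀ → ((p : ℕ) : 𝓞 ℚ) ∉ v.asIdeal → W.HasGoodReductionAt v)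
    (hbal : 1 + ∑ v ∈ S₀, delta W p v =
      ∑ v ∈ S₀, ((if φ (Rat.HeightOneSpectrum.natGenerator v : ZMod m) =
            (Rat.HeightOneSpectrum.natGenerator v : ZMod p)
          then sFactor p (Rat.HeightOneSpectrum.natGenerator v) else 0) +
        (if ψ (Rat.HeightOneSpectrum.natGenerator v : ZMod d) =
            (Rat.HeightOneSpectrum.natGenerator v : ZMod p)
          then sFactor p (Rat.HeightOneSpectrum.natGenerator v) else 0)))
    (K : Type) [Field K] [NumberField K] (hK : IsImaginaryQuadratic K)
    (hHN : SatisfiesHeegnerHypothesis (W.conductorNorm ℤ) K) (hHp : SatisfiesHeegnerHypothesis p K)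
    (hoddK : Odd (NumberField.discr K)) (hlt : NumberField.discr K < -4)
    {N₀ : ℕ} (hHN₀ : SatisfiesHeegnerHypothesis N₀ K)
    (hS₀N₀ : ∀ v ∈ S₀, Rat.HeightOneSpectrum.natGenerator v ∣ N₀)
    (hmK : m.Coprime (NumberField.discr K).natAbs) (hdK : d.Coprime (NumberField.discr K).natAbs)
    (hh : ¬ p ∣ BinaryQuadraticForm.classNumber (-((d * (NumberField.discr K).natAbs : ℕ) : ℤ)))
    (hr1 : (W.quadraticTwist (NumberField.discr K : ℚ)).analyticRank = 1) :
    ∃ (K : Type) (_ : Field K) (_ : NumberField K), IsImaginaryQuadratic K ∧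
      SatisfiesHeegnerHypothesis (W.conductorNorm ℤ) K ∧ SatisfiesHeegnerHypothesis p K ∧
      Odd (NumberField.discr K) ∧ NumberField.discr K < -4 ∧
      (W.quadraticTwist (NumberField.discr K : ℚ)).analyticRank = 1 ∧
      ∀ (Wd : WeierstrassCurve ℚ) [Wd.IsElliptic] [Wd.IsGloballyMinimal],
        (∃ C : VariableChange ℚ, C • Wd = W.quadraticTwist (NumberField.discr K : ℚ)) →
        MissingUpperBoundAt Wd p :=
  upperPartner_at_of_klFlat_partner hP hDis h311 W p hc hns K hK hHN hHp hoddK hlt hr1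
    (exists_klFlatCarrier_twist_of_ramifiedOdd W p hc.2.1 hns hΦ hram hodd φ ψ hφ hψ hpm hpd hquad hφ0 hψ0 S₀ hS₀p
      hS hbal K hK hHp (discr_emod_four_eq_one_of_odd hK.1 hoddK) hlt hHN₀ hS₀N₀ hmK hdK hh)

/-- **Stub 6 (∃-PARTNER) AT `(W, p)`, FIRST shape, the analytic rank DERIVED** — the same data WITHOUT
`ord_{s=1} L(E^{(d_K)}, s) = 1`: w5's door p650387 (`(μ_an, λ_an) = (0, 1)` ⟹ corank `≤ 1` ⟹ `= 1` by parity ⟹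
`r_an = 1` by Keller–Yin Thm. E, PRE) fed with part 1's carrier. Inputs BY NAME: `PublishedInputs`, Disegni Thm.
4(1), GV Thm. (3.11), Dokchitser (PUB); Keller–Yin Thm. E (PRE). [claim: KellerYin2024, status: under-review]
[cite: GreenbergVatsal2000, §3 Thm. (3.11) (p. 43)] [cite: DokchitserDokchitserAnnals2010, Thm. 1.4] [cite: Wuthrich2014, Thm. 16 (p. 397)] -/
theorem upperPartner_at_of_ramifiedOdd_of_classNumber_of_thmE (hP : EisensteinPrimes.PublishedInputs)
    (hDis : padicBSD_rankOne_nonsplitMult) (h311 : thm311_hasUnitContent_iff_and_order_eq_of_lineRamifiedEven)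
    (hDD : ∀ (V : WeierstrassCurve ℚ) [V.IsElliptic] (ℓ : ℕ) [Fact ℓ.Prime], selmerCorank_mod_two_eq V ℓ)
    (hKY : thmE_pConverse_semistable_OPEN)
    (hc : X2.CellB W p) (hns : ¬ W.HasSplitMultiplicativeReductionAtPrime p)
    {Φ₀ : AddSubgroup (geomTorsion W (p : ℤ))} (hΦ : IsRationalLine W p Φ₀)
    (hram : ¬ LineUnramifiedAt W p Φ₀) (hodd : LineOdd W p Φ₀)
    {m : ℕ} [NeZero m] (φ : DirichletCharacter (ZMod p) m) {d : ℕ} [NeZero d]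
    (ψ : DirichletCharacter (ZMod p) d) (hφ : φ.IsPrimitive) (hψ : ψ.IsPrimitive) (hpm : p ∣ m)
    (hpd : ¬ p ∣ d) (hquad : ψ.IsQuadratic)
    (hφ0 : ∀ (σ : absoluteGaloisGroup ℚ), ∀ P ∈ Φ₀,
      σ • P = (φ ((modNCyclotomicCharacter ℚ m σ : (ZMod m)ˣ) : ZMod m)).val • P)
    (hψ0 : ∀ (σ : absoluteGaloisGroup ℚ) (P : geomTorsion W (p : ℤ)),
      σ • P - (ψ ((modNCyclotomicCharacter ℚ d σ : (ZMod d)ˣ) : ZMod d)).val • P ∈ Φ₀)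
    (S₀ : Finset (HeightOneSpectrum (𝓞 ℚ))) (hS₀p : ∀ v ∈ S₀, ((p : ℕ) : 𝓞 ℚ) ∉ v.asIdeal)
    (hS : ∀ v : HeightOneSpectrum (𝓞 ℚ), v ∉ S₀ → ((p : ℕ) : 𝓞 ℚ) ∉ v.asIdeal → W.HasGoodReductionAt v)
    (hbal : 1 + ∑ v ∈ S₀, delta W p v =
      ∑ v ∈ S₀, ((if φ (Rat.HeightOneSpectrum.natGenerator v : ZMod m) =
            (Rat.HeightOneSpectrum.natGenerator v : ZMod p)
          then sFactor p (Rat.HeightOneSpectrum.natGenerator v) else 0) +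
        (if ψ (Rat.HeightOneSpectrum.natGenerator v : ZMod d) =
            (Rat.HeightOneSpectrum.natGenerator v : ZMod p)
          then sFactor p (Rat.HeightOneSpectrum.natGenerator v) else 0)))
    (K : Type) [Field K] [NumberField K] (hK : IsImaginaryQuadratic K)
    (hHN : SatisfiesHeegnerHypothesis (W.conductorNorm ℤ) K) (hHp : SatisfiesHeegnerHypothesis p K)
    (hoddK : Odd (NumberField.discr K)) (hlt : NumberField.discr K < -4)
    {N₀ : ℕ} (hHN₀ : SatisfiesHeegnerHypothesis N₀ K)
    (hS₀N₀ : ∀ v ∈ S₀, Rat.HeightOneSpectrum.natGenerator v ∣ N₀)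
    (hmK : m.Coprime (NumberField.discr K).natAbs) (hdK : d.Coprime (NumberField.discr K).natAbs)
    (hh : ¬ p ∣ BinaryQuadraticForm.classNumber (-((d * (NumberField.discr K).natAbs : ℕ) : ℤ))) :
    ∃ (K : Type) (_ : Field K) (_ : NumberField K), IsImaginaryQuadratic K ∧
      SatisfiesHeegnerHypothesis (W.conductorNorm ℤ) K ∧ SatisfiesHeegnerHypothesis p K ∧
      Odd (NumberField.discr K) ∧ NumberField.discr K < -4 ∧
      (W.quadraticTwist (NumberField.discr K : ℚ)).analyticRank = 1 ∧
      ∀ (Wd : WeierstrassCurve ℚ) [Wd.IsElliptic] [Wd.IsGloballyMinimal],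
        (∃ C : VariableChange ℚ, C • Wd = W.quadraticTwist (NumberField.discr K : ℚ)) →
        MissingUpperBoundAt Wd p :=
  upperPartner_at_of_klFlat_partner_of_thmE hP hDis h311 hDD hKY W p hc hns K hK hHN hHp hoddK hlt
    (exists_klFlatCarrier_twist_of_ramifiedOdd W p hc.2.1 hns hΦ hram hodd φ ψ hφ hψ hpm hpd hquad hφ0 hψ0 S₀ hS₀p
      hS hbal K hK hHp (discr_emod_four_eq_one_of_odd hK.1 hoddK) hlt hHN₀ hS₀N₀ hmK hdK hh)

/-! ## §2. SECOND shape (line of `E` unramified-even), `K` given -/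

/-- **Stub 6 (∃-PARTNER) AT `(W, p)`, SECOND shape, PUBLISHED inputs + the twist's analytic rank** — as
`upperPartner_at_of_ramifiedOdd_of_classNumber` with the line UNRAMIFIED-EVEN (`p ∤ m`, `p ∣ d`, `φ` quadratic-valued,
`p ∤ h(−m·|d_K|)`); part 2's carrier into LEAD g10's door. [cite: GreenbergVatsal2000, §3 Thm. (3.11) and §2 p. 28]
[cite: Disegni2020, Thm. 4 (§3.2)] [cite: Wuthrich2014, Thm. 16 (p. 397)] -/
theorem upperPartner_at_of_unramifiedEven_of_classNumber (hP : EisensteinPrimes.PublishedInputs)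
    (hDis : padicBSD_rankOne_nonsplitMult) (h311 : thm311_hasUnitContent_iff_and_order_eq_of_lineRamifiedEven)
    (hc : X2.CellB W p) (hns : ¬ W.HasSplitMultiplicativeReductionAtPrime p)
    {Φ₀ : AddSubgroup (geomTorsion W (p : ℤ))} (hΦ : IsRationalLine W p Φ₀)
    (hunr : LineUnramifiedAt W p Φ₀) (heven : LineEven W p Φ₀)
    {m : ℕ} [NeZero m] (φ : DirichletCharacter (ZMod p) m) {d : ℕ} [NeZero d]
    (ψ : DirichletCharacter (ZMod p) d) (hφ : φ.IsPrimitive) (hψ : ψ.IsPrimitive) (hpm : ¬ p ∣ m)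
    (hpd : p ∣ d) (hquad : φ.IsQuadratic)
    (hφ0 : ∀ (σ : absoluteGaloisGroup ℚ), ∀ P ∈ Φ₀,
      σ • P = (φ ((modNCyclotomicCharacter ℚ m σ : (ZMod m)ˣ) : ZMod m)).val • P)
    (hψ0 : ∀ (σ : absoluteGaloisGroup ℚ) (P : geomTorsion W (p : ℤ)),
      σ • P - (ψ ((modNCyclotomicCharacter ℚ d σ : (ZMod d)ˣ) : ZMod d)).val • P ∈ Φ₀)
    (S₀ : Finset (HeightOneSpectrum (𝓞 ℚ))) (hS₀p : ∀ v ∈ S₀, ((p : ℕ) : 𝓞 ℚ) ∉ v.asIdeal)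
    (hS : ∀ v : HeightOneSpectrum (𝓞 ℚ), v ∉ S₀ → ((p : ℕ) : 𝓞 ℚ) ∉ v.asIdeal → W.HasGoodReductionAt v)
    (hbal : 1 + ∑ v ∈ S₀, delta W p v =
      ∑ v ∈ S₀, ((if φ (Rat.HeightOneSpectrum.natGenerator v : ZMod m) =
            (Rat.HeightOneSpectrum.natGenerator v : ZMod p)
          then sFactor p (Rat.HeightOneSpectrum.natGenerator v) else 0) +
        (if ψ (Rat.HeightOneSpectrum.natGenerator v : ZMod d) =
            (Rat.HeightOneSpectrum.natGenerator v : ZMod p)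
          then sFactor p (Rat.HeightOneSpectrum.natGenerator v) else 0)))
    (K : Type) [Field K] [NumberField K] (hK : IsImaginaryQuadratic K)
    (hHN : SatisfiesHeegnerHypothesis (W.conductorNorm ℤ) K) (hHp : SatisfiesHeegnerHypothesis p K)
    (hoddK : Odd (NumberField.discr K)) (hlt : NumberField.discr K < -4)
    {N₀ : ℕ} (hHN₀ : SatisfiesHeegnerHypothesis N₀ K)
    (hS₀N₀ : ∀ v ∈ S₀, Rat.HeightOneSpectrum.natGenerator v ∣ N₀)
    (hmK : m.Coprime (NumberField.discr K).natAbs) (hdK : d.Coprime (NumberField.discr K).natAbs)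
    (hh : ¬ p ∣ BinaryQuadraticForm.classNumber (-((m * (NumberField.discr K).natAbs : ℕ) : ℤ)))
    (hr1 : (W.quadraticTwist (NumberField.discr K : ℚ)).analyticRank = 1) :
    ∃ (K : Type) (_ : Field K) (_ : NumberField K), IsImaginaryQuadratic K ∧
      SatisfiesHeegnerHypothesis (W.conductorNorm ℤ) K ∧ SatisfiesHeegnerHypothesis p K ∧
      Odd (NumberField.discr K) ∧ NumberField.discr K < -4 ∧
      (W.quadraticTwist (NumberField.discr K : ℚ)).analyticRank = 1 ∧
      ∀ (Wd : WeierstrassCurve ℚ) [Wd.IsElliptic] [Wd.IsGloballyMinimal],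
        (∃ C : VariableChange ℚ, C • Wd = W.quadraticTwist (NumberField.discr K : ℚ)) →
        MissingUpperBoundAt Wd p :=
  upperPartner_at_of_klFlat_partner hP hDis h311 W p hc hns K hK hHN hHp hoddK hlt hr1
    (exists_klFlatCarrier_twist_of_unramifiedEven W p hc.2.1 hns hΦ hunr heven φ ψ hφ hψ hpm hpd hquad hφ0 hψ0 S₀
      hS₀p hS hbal K hK hHp (discr_emod_four_eq_one_of_odd hK.1 hoddK) hlt hHN₀ hS₀N₀ hmK hdK hh)

/-- **Stub 6 (∃-PARTNER) AT `(W, p)`, SECOND shape, the analytic rank DERIVED** (w5's door p650387, Keller–Yin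
Thm. E PRE). [claim: KellerYin2024, status: under-review] [cite: GreenbergVatsal2000, §3 Thm. (3.11) and §2 p. 28]
[cite: DokchitserDokchitserAnnals2010, Thm. 1.4] [cite: Wuthrich2014, Thm. 16 (p. 397)] -/
theorem upperPartner_at_of_unramifiedEven_of_classNumber_of_thmE (hP : EisensteinPrimes.PublishedInputs)
    (hDis : padicBSD_rankOne_nonsplitMult) (h311 : thm311_hasUnitContent_iff_and_order_eq_of_lineRamifiedEven)
    (hDD : ∀ (V : WeierstrassCurve ℚ) [V.IsElliptic] (ℓ : ℕ) [Fact ℓ.Prime], selmerCorank_mod_two_eq V ℓ)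
    (hKY : thmE_pConverse_semistable_OPEN)
    (hc : X2.CellB W p) (hns : ¬ W.HasSplitMultiplicativeReductionAtPrime p)
    {Φ₀ : AddSubgroup (geomTorsion W (p : ℤ))} (hΦ : IsRationalLine W p Φ₀)
    (hunr : LineUnramifiedAt W p Φ₀) (heven : LineEven W p Φ₀)
    {m : ℕ} [NeZero m] (φ : DirichletCharacter (ZMod p) m) {d : ℕ} [NeZero d]
    (ψ : DirichletCharacter (ZMod p) d) (hφ : φ.IsPrimitive) (hψ : ψ.IsPrimitive) (hpm : ¬ p ∣ m)
    (hpd : p ∣ d) (hquad : φ.IsQuadratic)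
    (hφ0 : ∀ (σ : absoluteGaloisGroup ℚ), ∀ P ∈ Φ₀,
      σ • P = (φ ((modNCyclotomicCharacter ℚ m σ : (ZMod m)ˣ) : ZMod m)).val • P)
    (hψ0 : ∀ (σ : absoluteGaloisGroup ℚ) (P : geomTorsion W (p : ℤ)),
      σ • P - (ψ ((modNCyclotomicCharacter ℚ d σ : (ZMod d)ˣ) : ZMod d)).val • P ∈ Φ₀)
    (S₀ : Finset (HeightOneSpectrum (𝓞 ℚ))) (hS₀p : ∀ v ∈ S₀, ((p : ℕ) : 𝓞 ℚ) ∉ v.asIdeal)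
    (hS : ∀ v : HeightOneSpectrum (𝓞 ℚ), v ∉ S₀ → ((p : ℕ) : 𝓞 ℚ) ∉ v.asIdeal → W.HasGoodReductionAt v)
    (hbal : 1 + ∑ v ∈ S₀, delta W p v =
      ∑ v ∈ S₀, ((if φ (Rat.HeightOneSpectrum.natGenerator v : ZMod m) =
            (Rat.HeightOneSpectrum.natGenerator v : ZMod p)
          then sFactor p (Rat.HeightOneSpectrum.natGenerator v) else 0) +
        (if ψ (Rat.HeightOneSpectrum.natGenerator v : ZMod d) =
            (Rat.HeightOneSpectrum.natGenerator v : ZMod p)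
          then sFactor p (Rat.HeightOneSpectrum.natGenerator v) else 0)))
    (K : Type) [Field K] [NumberField K] (hK : IsImaginaryQuadratic K)
    (hHN : SatisfiesHeegnerHypothesis (W.conductorNorm ℤ) K) (hHp : SatisfiesHeegnerHypothesis p K)
    (hoddK : Odd (NumberField.discr K)) (hlt : NumberField.discr K < -4)
    {N₀ : ℕ} (hHN₀ : SatisfiesHeegnerHypothesis N₀ K)
    (hS₀N₀ : ∀ v ∈ S₀, Rat.HeightOneSpectrum.natGenerator v ∣ N₀)
    (hmK : m.Coprime (NumberField.discr K).natAbs) (hdK : d.Coprime (NumberField.discr K).natAbs)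
    (hh : ¬ p ∣ BinaryQuadraticForm.classNumber (-((m * (NumberField.discr K).natAbs : ℕ) : ℤ))) :
    ∃ (K : Type) (_ : Field K) (_ : NumberField K), IsImaginaryQuadratic K ∧
      SatisfiesHeegnerHypothesis (W.conductorNorm ℤ) K ∧ SatisfiesHeegnerHypothesis p K ∧
      Odd (NumberField.discr K) ∧ NumberField.discr K < -4 ∧
      (W.quadraticTwist (NumberField.discr K : ℚ)).analyticRank = 1 ∧
      ∀ (Wd : WeierstrassCurve ℚ) [Wd.IsElliptic] [Wd.IsGloballyMinimal],
        (∃ C : VariableChange ℚ, C • Wd = W.quadraticTwist (NumberField.discr K : ℚ)) →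
        MissingUpperBoundAt Wd p :=
  upperPartner_at_of_klFlat_partner_of_thmE hP hDis h311 hDD hKY W p hc hns K hK hHN hHp hoddK hlt
    (exists_klFlatCarrier_twist_of_unramifiedEven W p hc.2.1 hns hΦ hunr heven φ ψ hφ hψ hpm hpd hquad hφ0 hψ0 S₀
      hS₀p hS hbal K hK hHp (discr_emod_four_eq_one_of_odd hK.1 hoddK) hlt hHN₀ hS₀N₀ hmK hdK hh)

end Given

end Summit.BirchSwinnertonDyer.BirchSwinnertonDyer.Theorems.EisensteinPrimesMazurMCOnCellBTwistbackSubrowPartnerGiven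

end
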